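import Literature.Probability.LatticeModels.GaussianDomination
import Mathlib.Algebra.Order.Chebyshev
import HarnessLib

/-!
# Stub `stub_relocationPoincare` (line `cosh-budget-penrose-onsager`, crux
# `BECStronglyRayleigh.InsertionFieldDelocalisation`, stmt-AtomisticToContinuum-9673):
# the deterministic part — the canonical-path Poincaré inequality of the discrete torus

The registered stub asks for the RELOCATION POINCARÉ inequality in cosh form,
`disc · ‖Φ‖² · (N+1) ≤ C_P · L²√L · edgeDisc · wdisc`, for the level-`N+1` ground vector `ψ` of the
hard-core Bose gas on `(ℤ/Lℤ)³` and the Penrose–Onsager vector `Φ = poVec ψ'`. This file lands the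
part of it that is finite combinatorics, and records the diagnosis of what is missing.

## What is here (sorry-free)

* `cb5rp_coshGap_eq`: the cosh gap is a QUADRATIC form. With `a = Φ(S)`, `b = ψ(S)` and primes
  at `S'`, `(b a' - a b')² / (2 b b') = b b' (a/b - a'/b')² / 2`: both `disc` and `edgeDisc` are
  `ψ ⊗ ψ`-weighted Dirichlet forms of the single function `q = Φ/ψ` on `(N+1)`-sets. No
  exponential moment of `h = log ψ - log Φ` has to be chained along paths: the stub is a weighted
  (quadratic) Poincaré inequality for the token graph, weights = ground-state amplitudes.
* `cb5rp_sum_sq_prog_sub_le`: the cyclic one-dimensional Poincaré inequality in a finite abelian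
  group, `Σ_x (g(x + n v) - g x)² ≤ n² Σ_x (g(x + v) - g x)²` (telescoping + Cauchy–Schwarz +
  translation invariance of `Σ_x`).
* `cb5rp_sum_sq_shift_sub_le`, `cb5rp_torusPoincare`: the canonical-path (coordinate by
  coordinate) Poincaré inequality of the discrete torus `(ℤ/Lℤ)^d`,
  `Σ_x (g(x + a) - g x)² ≤ d L² Σ_x Σᵢ (g(x + eᵢ) - g x)²` for every shift `a`, hence
  `Σ_x Σ_y (g x - g y)² ≤ d L^{d+2} Σ_x Σᵢ (g(x + eᵢ) - g x)²` (paths of length `≤ d(L-1)`; the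
  sharp constant from the spectral gap `2(1 - cos(2π/L))` of the cycle is of the same order).
* `cb5rp_torusPoincare_adj`, `cb5rp_torusPoincare_weighted`: the same over the directed edges of
  `torusGraph d L` (`L ≥ 2`), and with pair weights `π ⊗ π` against edge weights `w` under the
  explicit comparability hypothesis `π(x)π(x') ≤ K w(y,y')` on edges (Diaconis–Stroock form with
  the crudest congestion bound); `stub_relocationPoincareTorus` is the registered `d = 3` form.

## What is NOT here, and why the registered statement is not closed

Per background `T` (`|T| = N`) the relocation form compares `q(T ∪ x)` with `q(T ∪ x')` for ALL
free `x, x'`, with weights `ψ(T∪x)ψ(T∪x')`; the token-edge form only has nearest-neighbour hops.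
(1) Paths moving only the inserted particle live in the punctured torus `Tᶜ`, which for admissible
`T` (any `N`-set, `2(N+1) ≤ L³`) can be disconnected (a free site caged by six particles): for such
`T` the `x`-only comparison fails for EVERY constant, so token paths that move background particles
are forced. Along the natural line-shift paths (on the coordinate line from `x` towards `x'` the
farthest background particle met advances to `x'`, every other one to the old position of the
next, and `x` to that of the first — farthest first, so that the background is restored) the
intermediate configurations differ from `T ∪ x` by up to two further relocated particles, and the background is recovered from an intermediate edge only up to `≍ L²`
choices (extra congestion), so even the unweighted count does not reproduce the free-torus exponent.
(2) The weights along any path are comparable only through the one-step Harnack bound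
`ψ(S') ≤ 6(N+1) ψ(S)` of the eigen-equation (`Σ_{S' ∼ S} ψ(S') = 2|E| ψ(S)`, `|E| ≤ 3(N+1)`), i.e.
with a constant geometric in the path length, not uniform in `N`.
(3) The normalisers matter: for a test vector `Φ` concentrated on one `(N+1)`-set `S₀` one has
`wdisc → N+1`, `‖Φ‖² → 1`, `edgeDisc → 2|E(N+1)| ≤ 6(N+1)` (eigen-equation) and
`disc → Σ_{u ∈ S₀, y ∉ S₀} ψ(S₀ - u + y)/ψ(S₀)`, which is `≍ (N+1)L³` as soon as one-particle
relocations of `ψ` are comparable; the registered inequality with `L^{5/2}` is then violated by a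
factor `≍ √L`. Hence the statement is specific to `Φ = poVec ψ'` through the FLATNESS of
`x ↦ Φ(T ∪ x)` (`wdisc ≍ L³ (N+1) ‖Φ‖²`), a Harnack-type property of the level-`N` ground state.
The missing input is therefore a genuinely many-body regularity statement for the sector ground
states (uniform comparability of one- and two-particle relocation amplitudes, and a Dirichlet-form
domination for the `ψ ⊗ ψ`-weighted token graph, uniform in the filling), not a property of the
torus; it is named precisely in the lead's ledger note for this stub.

References: Diaconis–Stroock, Ann. Appl. Probab. 1 (1991) 36–61 (canonical paths, Prop. 1);
Jerrum–Sinclair, Inform. and Comput. 82 (1989) 93–133; Levin–Peres, Markov Chains and Mixing Times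
(2017), §13.4 (the path method; the torus example).
-/

noncomputable section

open scoped BigOperators
open Finset Literature.Probability.LatticeModels

namespace Summit.AtomisticToContinuum.BoseEinsteinCondensation.Cruxes.InsertionFieldDelocalisation.CoshBudgetPenroseOnsager

/-! ### The cosh gap is a quadratic form in `q = Φ/ψ` -/

/-- **The cosh gap is quadratic in the ratio.** For `b, b' ≠ 0`,
`(b a' - a b')² / (2 b b') = b b' (a/b - a'/b')² / 2`; with `a = Φ(S)`, `b = ψ(S)` (and primes at
`S'`) the left side is `Φ(S)Φ(S')(cosh(h(S) - h(S')) - 1)`, `h = log ψ - log Φ`, and the right side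
is the `ψ(S)ψ(S')`-weighted squared increment of `q = Φ/ψ = e^{-h}`. [folklore] -/
theorem cb5rp_coshGap_eq (a b a' b' : ℝ) (hb : b ≠ 0) (hb' : b' ≠ 0) :
    (b * a' - a * b') ^ 2 / (2 * b * b') = b * b' * (a / b - a' / b') ^ 2 / 2 := by
  field_simp
  ring

/-! ### Telescoping and the cyclic one-dimensional Poincaré inequality -/

/-- **Telescoping Cauchy–Schwarz**: `(u n - u 0)² ≤ n Σ_{j<n} (u (j+1) - u j)²`. [folklore] -/
theorem cb5rp_sq_sub_le_mul_sum_sq (u : ℕ → ℝ) (n : ℕ) :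
    (u n - u 0) ^ 2 ≤ n * ∑ j ∈ range n, (u (j + 1) - u j) ^ 2 := by
  rw [← Finset.sum_range_sub u n]
  have h := sq_sum_le_card_mul_sum_sq (s := range n) (f := fun j => u (j + 1) - u j)
  rwa [card_range] at h

/-- **Cyclic one-dimensional Poincaré inequality** in a finite abelian group: along an arithmetic
progression `p j = j·v` (`p 0 = 0`, `p (j+1) = p j + v`),
`Σ_x (g(x + p n) - g x)² ≤ n² Σ_x (g(x + v) - g x)²` (telescope along `x, x + v, …, x + p n`,
Cauchy–Schwarz, and translation invariance of `Σ_x`). The progression is passed as data to keep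
the statement free of the `ℕ`-action. (Levin–Peres 2017, §13.4, the cycle.) [folklore] -/
theorem cb5rp_sum_sq_prog_sub_le {V : Type*} [AddCommGroup V] [Fintype V] (g : V → ℝ) (v : V)
    (p : ℕ → V) (hp0 : p 0 = 0) (hp : ∀ j, p (j + 1) = p j + v) (n : ℕ) :
    ∑ x, (g (x + p n) - g x) ^ 2 ≤ (n : ℝ) ^ 2 * ∑ x, (g (x + v) - g x) ^ 2 := by
  have hpt : ∀ x, (g (x + p n) - g x) ^ 2 ≤
      n * ∑ j ∈ range n, (g (x + p (j + 1)) - g (x + p j)) ^ 2 := by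
    intro x
    have h := cb5rp_sq_sub_le_mul_sum_sq (fun j => g (x + p j)) n
    simpa only [hp0, add_zero] using h
  calc ∑ x, (g (x + p n) - g x) ^ 2
      ≤ ∑ x, (n * ∑ j ∈ range n, (g (x + p (j + 1)) - g (x + p j)) ^ 2) :=
        sum_le_sum fun x _ => hpt x
    _ = n * ∑ j ∈ range n, ∑ x, (g (x + p (j + 1)) - g (x + p j)) ^ 2 := by
        rw [← mul_sum, sum_comm]
    _ = n * ∑ _j ∈ range n, ∑ x, (g (x + v) - g x) ^ 2 := by
        congr 1
        refine sum_congr rfl fun j _ => ?_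
        exact Fintype.sum_equiv (Equiv.addRight (p j)) _ _ fun x => by
          simp only [Equiv.coe_addRight, hp j, add_assoc]
    _ = (n : ℝ) ^ 2 * ∑ x, (g (x + v) - g x) ^ 2 := by
        rw [sum_const, card_range, nsmul_eq_mul]
        ring

/-- The weighted form of `(α + β)² ≤ 2α² + 2β²` used to chain increments with the sharp count:
`(α + β)² ≤ (1 + m) α² + (1 + 1/m) β²` for `m > 0` (it is `(m α - β)²/m ≥ 0`). [folklore] -/
theorem cb5rp_add_sq_le (α β m : ℝ) (hm : 0 < m) :
    (α + β) ^ 2 ≤ (1 + m) * α ^ 2 + (1 + 1 / m) * β ^ 2 := by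
  have h : (1 + m) * α ^ 2 + (1 + 1 / m) * β ^ 2 - (α + β) ^ 2 = (m * α - β) ^ 2 / m := by
    field_simp
    ring
  have h' : 0 ≤ (m * α - β) ^ 2 / m := div_nonneg (sq_nonneg _) hm.le
  linarith

/-! ### The canonical-path Poincaré inequality of the discrete torus `(ℤ/Lℤ)^d` -/

section Torus

variable {d L : ℕ} [NeZero L]

/-- **Shifts supported on a set of coordinates** (the induction behind the canonical paths): if the
shift `a` vanishes off `s`, then `Σ_x (g(x + a) - g x)² ≤ |s| L² Σ_x Σ_{i ∈ s} (g(x + eᵢ) - g x)²`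
(move coordinate by coordinate; each coordinate costs `L²` by the cyclic inequality, and the `|s|`
increments are combined with the weighted Cauchy–Schwarz `cb5rp_add_sq_le`). [folklore] -/
theorem cb5rp_sum_sq_shift_sub_le_of_support (g : TorusSite d L → ℝ) (s : Finset (Fin d)) :
    ∀ a : TorusSite d L, (∀ i ∉ s, a i = 0) →
      ∑ x, (g (x + a) - g x) ^ 2 ≤
        (s.card : ℝ) * (L : ℝ) ^ 2 * ∑ x, ∑ i ∈ s, (g (x + Pi.single i 1) - g x) ^ 2 := by
  classical
  refine Finset.induction_on s ?_ ?_
  · intro a ha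
    have ha0 : a = 0 := funext fun i => ha i (notMem_empty i)
    simp [ha0]
  · intro i s hi ih a ha
    -- split off the `i`-th coordinate: `a = a' + n eᵢ`, `a'` supported in `s`, `n < L`
    obtain ⟨a', n, hnL, ha', rfl⟩ : ∃ (a' : TorusSite d L) (n : ℕ), n < L ∧ (∀ j ∉ s, a' j = 0) ∧
        a = a' + Pi.single i ((n : ℕ) : ZMod L) := by
      refine ⟨Function.update a i 0, (a i).val, ZMod.val_lt _, fun j hj => ?_, funext fun j => ?_⟩
      · by_cases hji : j = i
        · rw [hji, Function.update_self]
        · rw [Function.update_of_ne hji]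
          exact ha j (by simp [hji, hj])
      · rw [ZMod.natCast_zmod_val]
        by_cases hji : j = i
        · subst hji
          simp
        · simp [Function.update_of_ne hji, Pi.single_eq_of_ne hji]
    -- the arithmetic progression `j ↦ j eᵢ`
    have hp0 : (Pi.single i ((0 : ℕ) : ZMod L) : TorusSite d L) = 0 := by simp
    have hp : ∀ j : ℕ, (Pi.single i ((j + 1 : ℕ) : ZMod L) : TorusSite d L) =
        Pi.single i ((j : ℕ) : ZMod L) + Pi.single i 1 := by
      intro j
      rw [← Pi.single_add, Nat.cast_succ]
    -- the increment in direction `i`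
    have hA : ∑ x, (g (x + (a' + Pi.single i ((n : ℕ) : ZMod L))) - g (x + a')) ^ 2 ≤
        (L : ℝ) ^ 2 * ∑ x, (g (x + Pi.single i 1) - g x) ^ 2 := by
      calc ∑ x, (g (x + (a' + Pi.single i ((n : ℕ) : ZMod L))) - g (x + a')) ^ 2
          = ∑ x, (g (x + Pi.single i ((n : ℕ) : ZMod L)) - g x) ^ 2 := by
            refine Fintype.sum_equiv (Equiv.addRight a') _ _ fun x => ?_
            simp only [Equiv.coe_addRight, add_assoc]
        _ ≤ (n : ℝ) ^ 2 * ∑ x, (g (x + Pi.single i 1) - g x) ^ 2 :=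
            cb5rp_sum_sq_prog_sub_le g (Pi.single i 1)
              (fun j : ℕ => (Pi.single i ((j : ℕ) : ZMod L) : TorusSite d L)) hp0 hp n
        _ ≤ (L : ℝ) ^ 2 * ∑ x, (g (x + Pi.single i 1) - g x) ^ 2 := by
            have hnL' : (n : ℝ) ≤ L := by exact_mod_cast hnL.le
            gcongr
    -- the increment supported in `s`
    have hB := ih a' ha'
    rw [card_insert_of_notMem hi]
    simp_rw [sum_insert hi]
    rw [sum_add_distrib]
    rcases s.eq_empty_or_nonempty with hs | hs
    · subst hs
      have ha'0 : a' = 0 := funext fun j => ha' j (notMem_empty j)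
      subst ha'0
      simpa using hA
    · have hm : (0 : ℝ) < s.card := by exact_mod_cast hs.card_pos
      calc ∑ x, (g (x + (a' + Pi.single i ((n : ℕ) : ZMod L))) - g x) ^ 2
          ≤ ∑ x, ((1 + (s.card : ℝ)) * (g (x + (a' + Pi.single i ((n : ℕ) : ZMod L))) - g (x + a')) ^ 2 +
              (1 + 1 / (s.card : ℝ)) * (g (x + a') - g x) ^ 2) :=
            sum_le_sum fun x _ => by
              rw [← sub_add_sub_cancel _ (g (x + a')) _]
              exact cb5rp_add_sq_le _ _ _ hm
        _ = (1 + (s.card : ℝ)) * ∑ x, (g (x + (a' + Pi.single i ((n : ℕ) : ZMod L))) - g (x + a')) ^ 2 +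
              (1 + 1 / (s.card : ℝ)) * ∑ x, (g (x + a') - g x) ^ 2 := by
            rw [sum_add_distrib, ← mul_sum, ← mul_sum]
        _ ≤ (1 + (s.card : ℝ)) * ((L : ℝ) ^ 2 * ∑ x, (g (x + Pi.single i 1) - g x) ^ 2) +
              (1 + 1 / (s.card : ℝ)) *
                ((s.card : ℝ) * (L : ℝ) ^ 2 * ∑ x, ∑ j ∈ s, (g (x + Pi.single j 1) - g x) ^ 2) := by
            gcongr
        _ = ((s.card + 1 : ℕ) : ℝ) * (L : ℝ) ^ 2 *
              (∑ x, (g (x + Pi.single i 1) - g x) ^ 2 +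
                ∑ x, ∑ j ∈ s, (g (x + Pi.single j 1) - g x) ^ 2) := by
            push_cast
            field_simp
            ring

/-- **Every shift costs at most `d L²` directed nearest-neighbour increments**: for every
`a ∈ (ℤ/Lℤ)^d`, `Σ_x (g(x + a) - g x)² ≤ d L² Σ_x Σᵢ (g(x + eᵢ) - g x)²` (canonical path: the
coordinates one after the other, `≤ L - 1` unit steps each). (Diaconis–Stroock 1991, Prop. 1;
Levin–Peres 2017, §13.4.) [folklore] -/
theorem cb5rp_sum_sq_shift_sub_le (g : TorusSite d L → ℝ) (a : TorusSite d L) :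
    ∑ x, (g (x + a) - g x) ^ 2 ≤
      (d : ℝ) * (L : ℝ) ^ 2 * ∑ x, ∑ i, (g (x + Pi.single i 1) - g x) ^ 2 := by
  have h := cb5rp_sum_sq_shift_sub_le_of_support g univ a fun i hi => absurd (mem_univ i) hi
  rwa [card_univ, Fintype.card_fin] at h

/-- **Canonical-path Poincaré inequality of the discrete torus** `(ℤ/Lℤ)^d`: for every real
function `g`, `Σ_x Σ_y (g x - g y)² ≤ d · L^{d+2} · Σ_x Σᵢ (g(x + eᵢ) - g x)²`, i.e. the variance
of `g` under the uniform law is at most `d L²/2` times its forward Dirichlet form per site (sum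
`cb5rp_sum_sq_shift_sub_le` over the `L^d` shifts). (Diaconis–Stroock 1991, Prop. 1 and the torus
example; Levin–Peres 2017, §13.4.) [folklore] -/
theorem cb5rp_torusPoincare (g : TorusSite d L → ℝ) :
    ∑ x, ∑ y, (g x - g y) ^ 2 ≤
      (d : ℝ) * (L : ℝ) ^ (d + 2) * ∑ x, ∑ i, (g (x + Pi.single i 1) - g x) ^ 2 := by
  calc ∑ x, ∑ y, (g x - g y) ^ 2
      = ∑ x, ∑ a, (g (x + a) - g x) ^ 2 := by
        refine sum_congr rfl fun x _ => (Fintype.sum_equiv (Equiv.addLeft x) _ _ fun a => ?_).symm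
        simp only [Equiv.coe_addLeft]
        ring
    _ = ∑ a, ∑ x, (g (x + a) - g x) ^ 2 := sum_comm
    _ ≤ ∑ _a : TorusSite d L, (d : ℝ) * (L : ℝ) ^ 2 * ∑ x, ∑ i, (g (x + Pi.single i 1) - g x) ^ 2 :=
        sum_le_sum fun a _ => cb5rp_sum_sq_shift_sub_le g a
    _ = (d : ℝ) * (L : ℝ) ^ (d + 2) * ∑ x, ∑ i, (g (x + Pi.single i 1) - g x) ^ 2 := by
        rw [sum_const, card_univ, Fintype.card_fun, ZMod.card, Fintype.card_fin, nsmul_eq_mul]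
        push_cast
        ring

/-- **Directed unit steps are edges of the torus graph** (`L ≥ 2`): for a function `F` of ordered
pairs that is nonnegative on edges, `Σ_x Σᵢ F(x, x + eᵢ) ≤ Σ_x Σ_{y ∼ x} F(x, y)` (the `d` sites
`x + eᵢ` are distinct neighbours of `x`; for `L ≥ 3` the right side also contains the `d` steps
`x - eᵢ`). [folklore] -/
theorem cb5rp_sum_single_le_sum_adj (hL : 2 ≤ L) (F : TorusSite d L → TorusSite d L → ℝ)
    (hF : ∀ x y, (torusGraph d L).Adj x y → 0 ≤ F x y) :
    ∑ x, ∑ i, F x (x + Pi.single i 1) ≤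
      ∑ x, ∑ y, (if (torusGraph d L).Adj x y then F x y else 0) := by
  refine sum_le_sum fun x _ => ?_
  rw [← sum_filter]
  calc ∑ i, F x (x + Pi.single i 1)
      = ∑ y ∈ univ.image (fun i : Fin d => x + Pi.single i 1), F x y := by
        rw [sum_image]
        intro i _ j _ h
        exact torus_single_injective hL (add_left_cancel h)
    _ ≤ ∑ y ∈ univ.filter ((torusGraph d L).Adj x), F x y := by
        refine sum_le_sum_of_subset_of_nonneg (fun y hy => ?_) (fun y hy _ => ?_)
        · obtain ⟨i, -, rfl⟩ := mem_image.1 hy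
          exact mem_filter.2 ⟨mem_univ _, torusGraph_adj_add_single hL x i⟩
        · exact hF x y (mem_filter.1 hy).2

/-- **Poincaré inequality of the torus graph** (`L ≥ 2`), directed-edge form:
`Σ_x Σ_y (g x - g y)² ≤ d · L^{d+2} · Σ_x Σ_{y ∼ x} (g x - g y)²`. [folklore] -/
theorem cb5rp_torusPoincare_adj (hL : 2 ≤ L) (g : TorusSite d L → ℝ) :
    ∑ x, ∑ y, (g x - g y) ^ 2 ≤
      (d : ℝ) * (L : ℝ) ^ (d + 2) *
        ∑ x, ∑ y, (if (torusGraph d L).Adj x y then (g x - g y) ^ 2 else 0) := by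
  refine (cb5rp_torusPoincare g).trans (mul_le_mul_of_nonneg_left ?_ (by positivity))
  calc ∑ x, ∑ i, (g (x + Pi.single i 1) - g x) ^ 2
      = ∑ x, ∑ i : Fin d, (g x - g (x + Pi.single i 1)) ^ 2 :=
        sum_congr rfl fun x _ => sum_congr rfl fun i _ => by ring
    _ ≤ ∑ x, ∑ y, (if (torusGraph d L).Adj x y then (g x - g y) ^ 2 else 0) :=
        cb5rp_sum_single_le_sum_adj hL (fun x y => (g x - g y) ^ 2) fun x y _ => sq_nonneg _

/-- **Weighted Poincaré inequality of the torus graph under comparability** (Diaconis–Stroock form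
with the crudest congestion bound): for pair weights `π ⊗ π` (`π ≥ 0`), edge weights `w` and a
constant `K` with `π(x)π(x') ≤ K · w(y, y')` for all sites `x, x'` and all directed edges
`y ∼ y'`, every real `g` satisfies
`Σ_{x,x'} π(x)π(x')(g x - g x')² ≤ d K L^{d+2} · Σ_{y ∼ y'} w(y,y')(g y - g y')²`.
(For the relocation problem of the crux: `π = ψ(T ∪ ·)`, `w(y,y') = ψ(T ∪ y)ψ(T ∪ y')` on the free
sites of a background `T`; the hypothesis is then a Harnack-type flatness of the one-particle
insertion amplitude of the ground state, which the eigen-equation alone (`ψ(S') ≤ 6(N+1) ψ(S)` for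
one token hop `S ∼ S'`) gives only with `K` geometric in the path length.) [folklore] -/
theorem cb5rp_torusPoincare_weighted (hL : 2 ≤ L) (g π : TorusSite d L → ℝ)
    (w : TorusSite d L → TorusSite d L → ℝ) (K : ℝ) (hπ : ∀ x, 0 ≤ π x)
    (hK : ∀ x x' y y', (torusGraph d L).Adj y y' → π x * π x' ≤ K * w y y') :
    ∑ x, ∑ x', π x * π x' * (g x - g x') ^ 2 ≤
      (d : ℝ) * K * (L : ℝ) ^ (d + 2) *
        ∑ y, ∑ y', (if (torusGraph d L).Adj y y' then w y y' * (g y - g y') ^ 2 else 0) := by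
  -- a maximiser of `π`
  obtain ⟨x₀, -, hx₀⟩ := exists_max_image univ π univ_nonempty
  have hP0 : 0 ≤ π x₀ * π x₀ := mul_nonneg (hπ x₀) (hπ x₀)
  have hππ : ∀ x x', π x * π x' ≤ π x₀ * π x₀ := fun x x' =>
    mul_le_mul (hx₀ x (mem_univ x)) (hx₀ x' (mem_univ x')) (hπ x') (hπ x₀)
  have hF : ∀ y y', (torusGraph d L).Adj y y' → 0 ≤ K * w y y' * (g y - g y') ^ 2 :=
    fun y y' h => mul_nonneg (hP0.trans (hK x₀ x₀ y y' h)) (sq_nonneg _)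
  have hpull : (d : ℝ) * K * (L : ℝ) ^ (d + 2) *
      ∑ y, ∑ y', (if (torusGraph d L).Adj y y' then w y y' * (g y - g y') ^ 2 else 0) =
      (d : ℝ) * (L : ℝ) ^ (d + 2) *
        ∑ y, ∑ y', (if (torusGraph d L).Adj y y' then K * w y y' * (g y - g y') ^ 2 else 0) := by
    rw [show (d : ℝ) * K * (L : ℝ) ^ (d + 2) = (d : ℝ) * (L : ℝ) ^ (d + 2) * K by ring,
      mul_assoc _ K, mul_sum]
    congr 1
    refine sum_congr rfl fun y _ => ?_
    rw [mul_sum]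
    refine sum_congr rfl fun y' _ => ?_
    split_ifs <;> ring
  rw [hpull]
  calc ∑ x, ∑ x', π x * π x' * (g x - g x') ^ 2
      ≤ ∑ x, ∑ x', π x₀ * π x₀ * (g x - g x') ^ 2 :=
        sum_le_sum fun x _ => sum_le_sum fun x' _ =>
          mul_le_mul_of_nonneg_right (hππ x x') (sq_nonneg _)
    _ = π x₀ * π x₀ * ∑ x, ∑ x', (g x - g x') ^ 2 := by
        rw [mul_sum]
        simp_rw [mul_sum]
    _ ≤ π x₀ * π x₀ *
          ((d : ℝ) * (L : ℝ) ^ (d + 2) * ∑ x, ∑ i, (g (x + Pi.single i 1) - g x) ^ 2) :=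
        mul_le_mul_of_nonneg_left (cb5rp_torusPoincare g) hP0
    _ = (d : ℝ) * (L : ℝ) ^ (d + 2) *
          ∑ x, ∑ i : Fin d, π x₀ * π x₀ * (g x - g (x + Pi.single i 1)) ^ 2 := by
        rw [mul_left_comm]
        congr 1
        rw [mul_sum]
        refine sum_congr rfl fun x _ => ?_
        rw [mul_sum]
        refine sum_congr rfl fun i _ => ?_
        ring
    _ ≤ (d : ℝ) * (L : ℝ) ^ (d + 2) *
          ∑ x, ∑ i : Fin d, K * w x (x + Pi.single i 1) * (g x - g (x + Pi.single i 1)) ^ 2 := by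
        refine mul_le_mul_of_nonneg_left (sum_le_sum fun x _ => sum_le_sum fun i _ => ?_)
          (by positivity)
        exact mul_le_mul_of_nonneg_right (hK x₀ x₀ _ _ (torusGraph_adj_add_single hL x i))
          (sq_nonneg _)
    _ ≤ (d : ℝ) * (L : ℝ) ^ (d + 2) *
          ∑ y, ∑ y', (if (torusGraph d L).Adj y y' then K * w y y' * (g y - g y') ^ 2 else 0) :=
        mul_le_mul_of_nonneg_left
          (cb5rp_sum_single_le_sum_adj hL (fun y y' => K * w y y' * (g y - g y') ^ 2) hF)
          (by positivity)

/-- **Registered sub-goal `stub_relocationPoincareTorus`** (helper of `stub_relocationPoincare`,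
line `cosh-budget-penrose-onsager`): the weighted canonical-path Poincaré inequality of the torus
graph `(ℤ/Lℤ)³`, `L ≥ 2` — for pair weights `π ⊗ π` (`π ≥ 0`) dominated on every directed edge by
`K ×` the edge weight `w`, `Σ_{x,x'} π(x)π(x')(g x - g x')² ≤ 3 K L⁵ Σ_{y ∼ y'} w(y,y')(g y - g y')²`
(`cb5rp_torusPoincare_weighted` at `d = 3`). This is the deterministic part of the relocation
Poincaré inequality; it does NOT close `stub_relocationPoincare` (see the module docstring).
[folklore] -/
theorem stub_relocationPoincareTorus :
    ∀ (L : ℕ) [NeZero L], 2 ≤ L → ∀ (g π : TorusSite 3 L → ℝ)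
      (w : TorusSite 3 L → TorusSite 3 L → ℝ) (K : ℝ), (∀ x, 0 ≤ π x) →
      (∀ x x' y y', (torusGraph 3 L).Adj y y' → π x * π x' ≤ K * w y y') →
      ∑ x, ∑ x', π x * π x' * (g x - g x') ^ 2 ≤
        3 * K * (L : ℝ) ^ 5 *
          ∑ y, ∑ y', (if (torusGraph 3 L).Adj y y' then w y y' * (g y - g y') ^ 2 else 0) := by
  intro L _ hL g π w K hπ hK
  have h := cb5rp_torusPoincare_weighted hL g π w K hπ hK
  norm_num at h
  exact h

end Torus

end Summit.AtomisticToContinuum.BoseEinsteinCondensation.Cruxes.InsertionFieldDelocalisation.CoshBudgetPenroseOnsager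

end
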